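import Summits.QuantumFields.YangMills.Theorems.BalabanUVNodesN19ClassSandwichAtRecord
import Summits.QuantumFields.YangMills.Theorems.BalabanUVNodesN19LedgerDress

/-!
# BalabanUVNodes ∕ N19 (NE7 proper) — THE REP⁰ JUNCTION AT THE RECORD: MODULE B's MGF identity for F3's dressed class weights + a REPRESENTATION of the class measure of slots
# (pushed to the unit lattice by the run's key map `A_{(pX K).K}`) as a ledger density pushed by the readings' field map ⇒ the DRESSED FORMAT of module 28 with
# `Wt := prodW ∘ fld`; hence the road-(i)-DRESSED N19 edge FOR `classWeightOfDatum₉` from NODE O's VACUUM ledger — lens decomp v8 ROW REP⁰ (M31), typed at MODULE B's objects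

Cell `pub-ymgap` (HUMAN RULING D-0062, Track A), R134 ACCELERATION seat `pub-ymgap-dag-n19-d` (strategy s2), gen 7, module 30.  Lens decomp v8 (`LENS-decomp.md` v8 §M31 ∕ ROW REP⁰ l.74: «→ NODE O
lineage with MODULE B's owner n19-d: when NODE O's `LedgerDataSync` instance is typed, state REP⁰ per `(K, τ, run)`: `(classMeasureOfSlots … (eX K τ)).map ((unitFactorisation D hD g₀).A (pX K).K)
= ((L.μ K 0 τ).withDensity (ofReal ∘ vacuum integrand of run X)).map fld` and conclude M29's `hP∕hQ` by `mgf_eq_dressedIntegral_of_rep` with `Wt := prodW N os ∘ fld` (`|Wt| ≤ 1`, measurable) — this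
is the ONLY observable-specific line on road (i)-dressed»).  NODE O's instance is NOT in the tree, so REP⁰ stays a displayed HYPOTHESIS `hrep` here; what IS typed is the junction at MODULE B's
objects and its composition with module 28's vacuum reading — so that NODE O owes exactly two named things per run: the VACUUM ledger and `hrep`.  Filed `--kind proof --supports
stmt-QuantumFields-20292 --as helper` (K3⁗).  COUNT-NEUTRAL.  THEOREMS ONLY; no Theses import; edits nothing.

* §1 ★ `classWeightOfDatum₉_eq_dressedIntegral_of_rep` — for a Stage-9 tuple at the identity selector (MODULE B p494399 `classWeightOfDatum₉_eq_mgf_of_ppSelId`), a run keyed by `p`, a unit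
  factorisation `Nf` of the datum's scheme (module 26 p500938 `prodObs_eq_prodW_comp_A`), a reference measure `μ` on readings `ι`, a density `f ≥ 0` and a field map `fld : ι → GaugeField (F.P 0) 0 (SU N)`
  with REP⁰ `(classMeasureOfSlots …).map (Nf.A p.K) = (μ.withDensity (ofReal ∘ f)).map fld`: the dressed class weight IS `∫ f v · e^{t·prodW(fld v)} dμ` for EVERY `t` (module 28
  `mgf_eq_dressedIntegral_of_rep`); `abs_prodW_comp_le_one` ∕ `measurable_prodW_comp` — the dressing observable `Wt := prodW ∘ fld` is measurable with `|Wt| ≤ 1`.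
* §2 ★ `coreEdge_classWeightOfDatum₉_of_vacuumLedgerAtSync_rep` — NODE O's VACUUM ledger `LedgerAtSync L l₀ vol T Bad (K _ τ ↦ P K 0 τ) (K _ τ ↦ Q K 0 τ) …` for the record's two runs' class
  weights `P K t τ := classWeightOfDatum₉ … (pA K) … t (eA K τ)`, `Q` likewise at `pB`, the in-edges BY NAME (exactly `core_summable_of_ledgerAtSync`'s), and REP⁰ for both runs on the good
  classes with the ledger's own integrands as densities ⇒ `∃ δ, Spine.NE7.Core l₀ vol T Bad P Q δ ∧ Summable δ` (module 28 `coreEdge_dress_of_vacuumLedgerAtSync` with `Wt := prodW ∘ fld`).  No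
  `MGFForm` hypothesis (it is MODULE B's theorem), no `TiltedMeanMatching`, no `0 < vol`, any `l₀`.

HONEST FRAMING.  ZERO ESTIMATE CONTENT: the vacuum ledger (37 fields at `t`-idle data) and REP⁰ are HYPOTHESES — NODE O's instance, inhabited by nobody in the tree; every in-edge letter is a
hypothesis; SCOPE = D1 observables (`prodObs` of the averaged fields) at the IDENTITY selector (live selector: swap `_of_ppSelLive`, one extra binder — not typed here); nothing of Bałaban's is
instantiated; NE7 NOT PROVED; N19 NOT discharged (0∕1); K3⁗ NOT claimed; counts UNMOVED (typed 28∕28 · discharged 5∕27, A 5∕28); one finite four-torus programme at fixed `ε` — NOT ℝ⁴ ∕ infinite volume ∕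
OS ∕ mass gap ∕ Clay.  0 `def`, 0 `sorry`; standard axioms; no decl below carries a cite tag.
-/

set_option autoImplicit false

noncomputable section

open Finset MeasureTheory ProbabilityTheory
open scoped BigOperators ENNReal Matrix.Norms.L2Operator

namespace Summit.QuantumFields.YangMills.BalabanUVNodes.N19LedgerDressAtRecord

open Literature.MathematicalPhysics.QuantumFieldTheory.Balaban1983to89
open Literature.MathematicalPhysics.QuantumFieldTheory.Balaban1983to89.Node00
open T4Continuum B14.Eq218Concrete
open T4OutputRate T4RecentScale T4GoodClassBudget T4CauchySum T4TowerRateComposition T4TowerRateDischarge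
open T4EtaRateMin (Readings NE3Shape)
open T4RateLiaison (GaugeDominated)
open Summit.QuantumFields.BalabanUV.T4Continuum.Spine
open Summit.QuantumFields.YangMills.BalabanUVNodes.N19MGFKernelTower (classMeasureOfSlots)
open Summit.QuantumFields.YangMills.BalabanUVNodes.N19MGFFormAtRecord (classWeightOfDatum₉_eq_mgf_of_ppSelId)
open Summit.QuantumFields.YangMills.BalabanUVNodes.N19ClassSandwichAtRecord (prodObs_eq_prodW_comp_A abs_prodW_le_one measurable_prodW)
open Summit.QuantumFields.YangMills.BalabanUVNodes.N19LedgerLinkSync (LedgerDataSync LedgerAtSync)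
open Summit.QuantumFields.YangMills.BalabanUVNodes.N19LedgerDress (mgf_eq_dressedIntegral_of_rep coreEdge_dress_of_vacuumLedgerAtSync)

/-! ## §1 REP⁰ ⇒ the dressed format of F3's class weights, observable `prodW ∘ fld` -/

section Rep

variable {F : T4Family} {N : ℕ} [NeZero N] {ι : Type} [MeasurableSpace ι]

omit [MeasurableSpace ι] in
/-- The dressing observable `prodW ∘ fld` is bounded by `1` (module 26 `abs_prodW_le_one`). [folklore] -/
theorem abs_prodW_comp_le_one {G O : Type*} {S : Missing.TorusScheme G O} [MeasurableSpace G] {X : Type*} [MeasurableSpace X]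
    (Nf : T4VarianceMatching.UnitFactorisation S X) (os : List O) (fld : ι → X) (v : ι) :
    |((fun u => (os.map fun o => Nf.W o u).prod) ∘ fld) v| ≤ 1 :=
  abs_prodW_le_one Nf os (fld v)

/-- … and measurable for a measurable field map (module 26 `measurable_prodW`). [folklore] -/
theorem measurable_prodW_comp {G O : Type*} {S : Missing.TorusScheme G O} [MeasurableSpace G] {X : Type*} [MeasurableSpace X]
    (Nf : T4VarianceMatching.UnitFactorisation S X) (os : List O) {fld : ι → X} (hfld : Measurable fld) :
    Measurable ((fun u => (os.map fun o => Nf.W o u).prod) ∘ fld) :=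
  (measurable_prodW Nf os).comp hfld

/-- **★ REP⁰ ⇒ THE DRESSED FORMAT OF F3's CLASS WEIGHT** [bookkeeping] (lens v8 M31: MODULE B `classWeightOfDatum₉_eq_mgf_of_ppSelId` + module 26 `prodObs_eq_prodW_comp_A` + module 28
`mgf_eq_dressedIntegral_of_rep`): for a Stage-9 tuple `ϑ` at the identity selector with the displayed `w`∕`χ` laws, a run keyed by `p` with slot data `g`, `k`, a unit factorisation `Nf` of the scheme
`D.scheme g₀`, and a REPRESENTATION `hrep` of the class measure of slots of the sequence `s` — pushed to the unit lattice by the run's key map `Nf.A p.K` — as the density `f ≥ 0` against the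
reference measure `μ` on the readings, pushed by the field map `fld`: for EVERY source `t`,
`classWeightOfDatum₉ F N ϑ D g₀ os p g k t s = ∫ v, f v * exp (t * prodW(fld v)) ∂μ`.  REP⁰ is NODE O's object-bound statement (a HYPOTHESIS here). [folklore] -/
theorem classWeightOfDatum₉_eq_dressedIntegral_of_rep (ϑ : Stage9Params F N) (hsel : ϑ.ppSel = ppSelIdOfRecord F ϑ.ν ϑ.τ9.M) {p : B12.RunParams} {g : ℕ → ℝ}
    (hw0 : ∀ k s' U V', 0 ≤ wOfRecord₉ F N ϑ p g k s' U V')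
    (hwm : ∀ k s', Measurable fun z : GaugeField (F.P p.K) (k + 1) (SU N) × GaugeField (F.P p.K) k (SU N) => wOfRecord₉ F N ϑ p g k s' z.2 z.1)
    (hχm : ∀ k s, Measurable (chiSeqOfRecord F N ϑ.ν ϑ.τ9.M g p.K k s)) (D : FiniteEpsData F (SU N)) (hD : D.AvgMeasurable)
    (g₀ : ℕ → ℝ) (os : List (ULoop F)) (Nf : T4VarianceMatching.UnitFactorisation (D.scheme g₀) (GaugeField (F.P 0) 0 (SU N)))
    (k : ℕ) (s : SeqOfRecord F ϑ.ν ϑ.τ9.M g p.K k) {μ : Measure ι} {f : ι → ℝ} (hfm : Measurable f) (hf0 : ∀ v, 0 ≤ f v)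
    {fld : ι → GaugeField (F.P 0) 0 (SU N)} (hfld : Measurable fld)
    (hrep : (classMeasureOfSlots F N ϑ.ν ϑ.τ9 (wOfRecord₉ F N ϑ) p g (Missing.boltzmann (F.P p.K) ((g₀ p.K)⁻¹ ^ 2)) k s).map (Nf.A p.K) =
      (μ.withDensity fun v => ENNReal.ofReal (f v)).map fld) (t : ℝ) :
    classWeightOfDatum₉ F N ϑ D g₀ os p g k t s = ∫ v, f v * Real.exp (t * ((fun u => (os.map fun o => Nf.W o u).prod) ∘ fld) v) ∂μ := by
  rw [classWeightOfDatum₉_eq_mgf_of_ppSelId ϑ hsel hw0 hwm hχm D hD g₀ os k t s]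
  have hobs : T4GenFunBounds.prodObs (D.scheme g₀) p.K os = (fun u => (os.map fun o => Nf.W o u).prod) ∘ Nf.A p.K :=
    prodObs_eq_prodW_comp_A Nf p.K os
  simp only [mgf, hobs, Function.comp_apply]
  exact mgf_eq_dressedIntegral_of_rep (Nf.measurable_A p.K) hfm hf0 hfld (measurable_prodW Nf os) hrep t

end Rep

/-! ## §2 The road-(i)-DRESSED N19 edge FOR F3's class weights from NODE O's VACUUM ledger + REP⁰ (module 28's vacuum reading at `Wt := prodW ∘ fld`) -/

section Edge

variable {F : T4Family} {N : ℕ} [NeZero N]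
  {C : Carriers} [DecidableEq C.Dom] {F' : Type*} {ι X : Type} [MeasurableSpace ι] {σ : Type*} [DecidableEq σ]
  {L : LedgerDataSync C F' ι σ} {l₀ vol : ℝ} {T : ℕ → Finset σ} {Bad : ℕ → ℝ → Finset σ}
  {R : Readings ι X} {W : Set (ℕ → ℝ)} {EA : Functional C C.BgA} {EB : Functional C C.BgB}
  {κ θ₅ C₅ C₉ ω θc Cd γ C₃ θ₃ Pg : ℝ} {q : ℕ} {Λm : ℕ → ℕ → ℝ} {CU : (ℕ → ℝ) → ℕ → ℝ}
  {gc : ℕ → ℕ → ℝ} {uA : ℕ → ι → C.BgA} {uB : ℕ → ι → C.BgB}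

/-- **★ THE ROAD-(i)-DRESSED N19 EDGE FOR F3's DRESSED CLASS WEIGHTS** [bookkeeping] (lens v8 ROW REP⁰ closed at MODULE B's objects: module 28 `coreEdge_dress_of_vacuumLedgerAtSync` with
`Wt := prodW ∘ fld`, its `hP`∕`hQ` supplied by §1 under REP⁰).  DATA: a Stage-9 tuple `ϑ` at the identity selector with the `w`∕`χ` laws; two runs of the record keyed by `pA pB : ℕ → RunParams` (slot
data `gA kA eA` ∕ `gB kB eB`, classes indexed by `σ` through `eX K : σ → SeqOfRecord …`); a unit factorisation `Nf` of `D.scheme g₀`; NODE O's synchronised VACUUM ledger `hL` whose cores are the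
UNDRESSED class weights `(K, _, τ) ↦ classWeightOfDatum₉ … (pA K) … 0 (eA K τ)` (run A) and likewise (run B); the in-edges BY NAME (`core_summable_of_ledgerAtSync`'s: NE3Shape ∕ GaugeDominated ∕ NE5 ∕
NE9+FadingMemory ∕ InjectedRate ∕ box ∕ LipBackground ∕ PolyLipGrowth ∕ W-membership); a measurable field map `fld` from the ledger's readings to the unit-lattice fields; and REP⁰ on the good classes for
BOTH runs with the ledger's OWN integrands as densities (`hrepA`∕`hrepB`, with their measurability∕nonnegativity `hfmA hf0A hfmB hf0B` — NODE O's object-bound statements).  CONCLUSION: `∃ δ, Spine.NE7.Core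
l₀ vol T Bad P Q δ ∧ Summable δ` for the DRESSED class weights `P K t τ = classWeightOfDatum₉ … t (eA K τ)`, `Q` likewise — no `MGFForm` hypothesis, no `TiltedMeanMatching`, no `0 < vol`, any `l₀`.
Every binder a HYPOTHESIS (0∕1 today); NOT NE7. [folklore] -/
theorem coreEdge_classWeightOfDatum₉_of_vacuumLedgerAtSync_rep (ϑ : Stage9Params F N) (hsel : ϑ.ppSel = ppSelIdOfRecord F ϑ.ν ϑ.τ9.M)
    (hw0 : ∀ p g k s' U V', 0 ≤ wOfRecord₉ F N ϑ p g k s' U V')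
    (hwm : ∀ (p : B12.RunParams) (g : ℕ → ℝ) k s',
      Measurable fun z : GaugeField (F.P p.K) (k + 1) (SU N) × GaugeField (F.P p.K) k (SU N) => wOfRecord₉ F N ϑ p g k s' z.2 z.1)
    (hχm : ∀ (p : B12.RunParams) (g : ℕ → ℝ) k s, Measurable (chiSeqOfRecord F N ϑ.ν ϑ.τ9.M g p.K k s))
    (D : FiniteEpsData F (SU N)) (hD : D.AvgMeasurable) (g₀ : ℕ → ℝ) (os : List (ULoop F))
    (Nf : T4VarianceMatching.UnitFactorisation (D.scheme g₀) (GaugeField (F.P 0) 0 (SU N)))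
    (pA pB : ℕ → B12.RunParams) (gA gB : ℕ → ℕ → ℝ) (kA kB : ℕ → ℕ)
    (eA : ∀ K, σ → SeqOfRecord F ϑ.ν ϑ.τ9.M (gA K) (pA K).K (kA K)) (eB : ∀ K, σ → SeqOfRecord F ϑ.ν ϑ.τ9.M (gB K) (pB K).K (kB K))
    (hL : LedgerAtSync L l₀ vol T Bad (fun K _ τ => classWeightOfDatum₉ F N ϑ D g₀ os (pA K) (gA K) (kA K) 0 (eA K τ))
      (fun K _ τ => classWeightOfDatum₉ F N ϑ D g₀ os (pB K) (gB K) (kB K) 0 (eB K τ)) R EA EB κ gc uA uB ω θc θ₅ θ₃)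
    (h16 : NE3Shape R C₃ θ₃) (hC₃ : 0 ≤ C₃) (hgd : GaugeDominated R uA uB)
    (h18 : NE5 EA EB W κ θ₅ C₅) (hθ₅ : 0 ≤ θ₅) (hC₅ : 0 ≤ C₅)
    (h22 : NE9 EA W κ Λm ∧ T4OutputRate.FadingMemory C₉ ω Λm) (hω : 0 ≤ ω)
    (hinj : InjectedRate Cd 0 θc (fun K j => T4CouplingMatching.disc (gc K) (gc (K + 1)) j)) (hCd : 0 ≤ Cd)
    (hθc : 0 ≤ θc) (hbox : ∀ K i, i ≤ K → 0 < gc K i ∧ gc K i ≤ γ)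
    (hU : LipBackground EA W κ CU) (hG : PolyLipGrowth CU gc Pg q) (hPg : 0 ≤ Pg)
    (hgA : ∀ K, gc K ∈ W) (hgB : ∀ K, (fun i => gc (K + 1) (i + 1)) ∈ W)
    {fld : ι → GaugeField (F.P 0) 0 (SU N)} (hfld : Measurable fld)
    (hfmA : ∀ K t, |t| ≤ l₀ → ∀ τ ∈ T K \ Bad K t,
      Measurable fun v => (∏ Xd ∈ L.fac K t τ, Real.exp (EA (gc K) (uA K v) Xd - EA (gc K) L.oneA Xd)) * L.oA K t τ v)
    (hf0A : ∀ K t, |t| ≤ l₀ → ∀ τ ∈ T K \ Bad K t, ∀ v,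
      0 ≤ (∏ Xd ∈ L.fac K t τ, Real.exp (EA (gc K) (uA K v) Xd - EA (gc K) L.oneA Xd)) * L.oA K t τ v)
    (hrepA : ∀ K t, |t| ≤ l₀ → ∀ τ ∈ T K \ Bad K t,
      (classMeasureOfSlots F N ϑ.ν ϑ.τ9 (wOfRecord₉ F N ϑ) (pA K) (gA K) (Missing.boltzmann (F.P (pA K).K) ((g₀ (pA K).K)⁻¹ ^ 2)) (kA K) (eA K τ)).map
          (Nf.A (pA K).K) =
        ((L.μ K t τ).withDensity fun v => ENNReal.ofReal
          ((∏ Xd ∈ L.fac K t τ, Real.exp (EA (gc K) (uA K v) Xd - EA (gc K) L.oneA Xd)) * L.oA K t τ v)).map fld)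
    (hfmB : ∀ K t, |t| ≤ l₀ → ∀ τ ∈ T K \ Bad K t,
      Measurable fun v => (∏ Xd ∈ L.fac K t τ,
        Real.exp (EB (fun i => gc (K + 1) (i + 1)) (uB K v) Xd - EB (fun i => gc (K + 1) (i + 1)) L.oneB Xd)) * L.oB K t τ v)
    (hf0B : ∀ K t, |t| ≤ l₀ → ∀ τ ∈ T K \ Bad K t, ∀ v,
      0 ≤ (∏ Xd ∈ L.fac K t τ,
        Real.exp (EB (fun i => gc (K + 1) (i + 1)) (uB K v) Xd - EB (fun i => gc (K + 1) (i + 1)) L.oneB Xd)) * L.oB K t τ v)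
    (hrepB : ∀ K t, |t| ≤ l₀ → ∀ τ ∈ T K \ Bad K t,
      (classMeasureOfSlots F N ϑ.ν ϑ.τ9 (wOfRecord₉ F N ϑ) (pB K) (gB K) (Missing.boltzmann (F.P (pB K).K) ((g₀ (pB K).K)⁻¹ ^ 2)) (kB K) (eB K τ)).map
          (Nf.A (pB K).K) =
        ((L.μ K t τ).withDensity fun v => ENNReal.ofReal
          ((∏ Xd ∈ L.fac K t τ,
            Real.exp (EB (fun i => gc (K + 1) (i + 1)) (uB K v) Xd - EB (fun i => gc (K + 1) (i + 1)) L.oneB Xd)) * L.oB K t τ v)).map fld) :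
    ∃ δ : ℕ → ℝ, NE7.Core l₀ vol T Bad (fun K t τ => classWeightOfDatum₉ F N ϑ D g₀ os (pA K) (gA K) (kA K) t (eA K τ))
      (fun K t τ => classWeightOfDatum₉ F N ϑ D g₀ os (pB K) (gB K) (kB K) t (eB K τ)) δ ∧ Summable δ :=
  coreEdge_dress_of_vacuumLedgerAtSync (Wt := (fun u => (os.map fun o => Nf.W o u).prod) ∘ fld) (Bw := 1) hL h16 hC₃ hgd h18 hθ₅ hC₅ h22 hω
    hinj hCd hθc hbox hU hG hPg hgA hgB (measurable_prodW_comp Nf os hfld) (abs_prodW_comp_le_one Nf os fld)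
    (fun K t ht τ hτ => classWeightOfDatum₉_eq_dressedIntegral_of_rep ϑ hsel (hw0 _ _) (hwm _ _) (hχm _ _) D hD g₀ os Nf (kA K) (eA K τ)
      (hfmA K t ht τ hτ) (hf0A K t ht τ hτ) hfld (hrepA K t ht τ hτ) t)
    (fun K t ht τ hτ => classWeightOfDatum₉_eq_dressedIntegral_of_rep ϑ hsel (hw0 _ _) (hwm _ _) (hχm _ _) D hD g₀ os Nf (kB K) (eB K τ)
      (hfmB K t ht τ hτ) (hf0B K t ht τ hτ) hfld (hrepB K t ht τ hτ) t)

end Edge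

end Summit.QuantumFields.YangMills.BalabanUVNodes.N19LedgerDressAtRecord

end
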